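import Literature.Analysis.FluidPDE.FourierL2PicardBounds
import Mathlib.Analysis.LConvolution
import HarnessLib

/-!
# Envelopes of the Picard iterates: the master `λ`-step and the `λ`-free majorants

Eleventh file of the weighted-`L²` Fourier-side construction of the local smooth solution of the
Navier–Stokes system with `H¹`-controlled lifespan (discharge of
`Literature.Analysis.FluidPDE.tao2011_fourier_local_existence`; Tao 2013, Thm. 5.4 (ii)+(iv)).

After the uniform `X¹`/`X²` bounds of `FourierL2PicardBounds`, the higher regularity of the
iterates `v_n = h - E_n` (`h = heat • a`, `E_{n+1} = duhamelIntegral c T v_n`) and the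
convergence of the scheme are obtained by the exponential-time-weight (`e^{-λt}`) method on the
Fourier side, pointwise in the frequency. This file provides its two inputs.

* `exp_mul_weight_mul_enorm_bilinDuhamel_le_of_lconv`: the **master `λ`-step** — for
  `c, λ > 0`, `t ∈ [0, T]`,
  `e^{-λt}(1+‖ξ‖)^k ‖∫₀ᵗ heat(t-s) • N(p s, q s)(ξ) ds‖ₑ ≤ (2√(cλ))⁻¹ C_N 2^k (X₁ ξ + X₂ ξ)`
  whenever `e^{-λs} (M_p(s) ⋆ₗ w^k M_q(s)) ≤ X₁` and `e^{-λs} (w^k M_p(s) ⋆ₗ M_q(s)) ≤ X₂` on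
  `[0, T]` (the user decides which factor carries the exponential weight; the version with fixed
  envelopes is `exp_mul_weight_mul_enorm_bilinDuhamel_le`).
* `enorm_duhamelIntegral_hsub_le_psi`, `lintegral_weight_four_psi_sq_le`: the **`λ`-free,
  time-uniform envelope** `‖E'(t, η)‖ₑ ≤ Ψ(η) = (min((2c)⁻¹, ‖η‖²T) Φ²(η))^{1/2}` of the Duhamel
  part of the next iterate, with `∫ (1+‖η‖)⁴ Ψ² ≤ 8 (T I₁ + (2c)⁻¹ I₂)` — hence (Cauchy–Schwarz
  with `(1+‖η‖)^{-2} ∈ L²(ℝ³)`) an `L¹ ∩ L²` majorant of `M_{E'}` **uniform in `n`** along the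
  Picard iteration (`I₁`, `I₂` are uniformly bounded by `FourierL2PicardBounds`).

## Wide class (forced twin)

Every theorem of this file taking `hEc : Continuous (uncurry E)` has a primed twin taking instead
`(hEm : Measurable (uncurry E)) (hEt : ∀ η, Continuous fun s => E s η)` — joint measurability and
continuity in time at each frequency, which is all the proofs use of the joint continuity (slice
and joint measurability, dominated convergence in time). This is the class of `E = D - F`, `D`
jointly continuous, `F = ∫₀ᵗ heat(t-s) • b(s) ds` a forcing term whose Leray-projected coefficient
`b` is discontinuous at `ξ = 0` (forced twin `ForcedFourier*`; Tao 2013, Thm. 5.4 is stated and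
proved WITH the force). The unprimed theorems are their specialisations.

## References

* T. Tao, Anal. PDE 6 (2013) = arXiv:1108.1165, Lemma 2.1 = arXiv Lemma 23 and the proof of
  Thm. 5.1/5.4 (arXiv pp. 16, 18: "the estimates for higher `k` follow from variants of the above
  argument and an induction on `k`"). [Tao2011]
-/

noncomputable section

open MeasureTheory Real Set Filter Function intervalIntegral
open scoped ENNReal NNReal
open _root_.Topology

namespace Literature.Analysis.FluidPDE.FourierNS

variable {ι : Type*} [Fintype ι] [DecidableEq ι]

/-! ### The majorant against the sup norm -/

omit [DecidableEq ι] in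
/-- `∑ⱼ ‖xⱼ‖ₑ ≤ card ι · ‖x‖ₑ` for `x : ι → ℂ`. [folklore] -/
theorem majorant_le_card_mul_enorm (x : ι → ℂ) :
    (∑ j, ‖x j‖ₑ) ≤ (Fintype.card ι : ℝ≥0∞) * ‖x‖ₑ := by
  have h1 : ∀ j, ‖x j‖ₑ ≤ ‖x‖ₑ := fun j => by
    rw [← ofReal_norm, ← ofReal_norm]; exact ENNReal.ofReal_le_ofReal (norm_le_pi_norm x j)
  calc (∑ j, ‖x j‖ₑ) ≤ ∑ _j : ι, ‖x‖ₑ := Finset.sum_le_sum fun j _ => h1 j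
    _ = (Fintype.card ι : ℝ≥0∞) * ‖x‖ₑ := by simp [Finset.sum_const, Finset.card_univ]

/-! ### The master `λ`-step -/

section Master

variable {p q : ℝ → EuclideanSpace ℝ ι → ι → ℂ} {c T : ℝ}

/-- **Master weighted envelope step** for the bilinear Duhamel integral: if on `[0, T]` the two
Peetre products obey `e^{-λs} (M_p(s) ⋆ₗ (1+‖·‖)^k M_q(s))(ξ) ≤ X₁ ξ` and
`e^{-λs} ((1+‖·‖)^k M_p(s) ⋆ₗ M_q(s))(ξ) ≤ X₂ ξ` (`M_p(s) = ∑ⱼ ‖p s ·j‖ₑ`), then for `c, λ > 0`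
and `t ∈ [0, T]`,

  `e^{-λt}(1+‖ξ‖)^k ‖∫₀ᵗ heat(t-s) • N(p s, q s)(ξ) ds‖ₑ ≤ (2√(cλ))⁻¹ 4π(card ι)² 2^k (X₁ ξ + X₂ ξ)`

(`‖N‖ₑ ≤ 4π card² ‖ξ‖ (M_p ⋆ₗ M_q)`, Peetre `w^k(ξ) ≤ 2^k(w^k(η) + w^k(ξ-η))`, and the `L¹_t`
kernel gain `‖ξ‖ ∫₀ᵗ e^{-(c‖ξ‖²+λ)(t-s)} ds ≤ (2√(cλ))⁻¹`, `exp_mul_enorm_duhamel_le`). [folklore] -/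
theorem exp_mul_weight_mul_enorm_bilinDuhamel_le_of_lconv (hc : 0 < c) {lam : ℝ} (hlam : 0 < lam)
    (hpm : ∀ s, AEStronglyMeasurable (p s) volume) (hqm : ∀ s, AEStronglyMeasurable (q s) volume)
    (k : ℕ) {X₁ X₂ : EuclideanSpace ℝ ι → ℝ≥0∞} (ξ : EuclideanSpace ℝ ι)
    (h1 : ∀ s ∈ Icc 0 T, ENNReal.ofReal (Real.exp (-lam * s)) *
      ((fun η => ∑ j, ‖p s η j‖ₑ) ⋆ₗ (fun η => ENNReal.ofReal ((1 + ‖η‖) ^ k) * ∑ j, ‖q s η j‖ₑ)) ξ ≤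
        X₁ ξ)
    (h2 : ∀ s ∈ Icc 0 T, ENNReal.ofReal (Real.exp (-lam * s)) *
      ((fun η => ENNReal.ofReal ((1 + ‖η‖) ^ k) * ∑ j, ‖p s η j‖ₑ) ⋆ₗ (fun η => ∑ j, ‖q s η j‖ₑ)) ξ ≤
        X₂ ξ)
    {t : ℝ} (ht : t ∈ Icc 0 T) :
    ENNReal.ofReal (Real.exp (-lam * t)) * (ENNReal.ofReal ((1 + ‖ξ‖) ^ k) *
        ‖∫ s in (0 : ℝ)..t, heat c ξ (t - s) • nonlin (p s) (q s) ξ‖ₑ) ≤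
      ENNReal.ofReal (1 / (2 * Real.sqrt (c * lam))) * (ENNReal.ofReal (4 * π) *
        (Fintype.card ι : ℝ≥0∞) ^ 2 * 2 ^ k * (X₁ ξ + X₂ ξ)) := by
  set W : ℝ := (1 + ‖ξ‖) ^ k with hW
  have hW0 : 0 ≤ W := by positivity
  -- sup norm from the components
  have hpi : ∀ {x : ι → ℂ} {b : ℝ≥0∞}, (∀ l, ‖x l‖ₑ ≤ b) → ‖x‖ₑ ≤ b := by
    intro x b h
    rcases eq_or_ne b ⊤ with hb | hb
    · rw [hb]; exact le_top
    rw [← ofReal_norm, ← ENNReal.ofReal_toReal hb]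
    refine ENNReal.ofReal_le_ofReal ((pi_norm_le_iff_of_nonneg ENNReal.toReal_nonneg).2 fun l => ?_)
    rw [← ENNReal.ofReal_le_ofReal_iff ENNReal.toReal_nonneg, ofReal_norm, ENNReal.ofReal_toReal hb]
    exact h l
  set C : ℝ≥0∞ := ENNReal.ofReal (4 * π) * (Fintype.card ι : ℝ≥0∞) ^ 2 with hC
  set P : ℝ → EuclideanSpace ℝ ι → ℝ≥0∞ := fun s η => ∑ j, ‖p s η j‖ₑ with hP
  set Q : ℝ → EuclideanSpace ℝ ι → ℝ≥0∞ := fun s η => ∑ j, ‖q s η j‖ₑ with hQ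
  have hPm : ∀ s, AEMeasurable (P s) volume := fun s => aemeasurable_majorant (hpm s)
  have hQm : ∀ s, AEMeasurable (Q s) volume := fun s => aemeasurable_majorant (hqm s)
  -- the rescaled nonlinearity `W • N`
  set N' : ℝ → (ι → ℂ) := fun s => W • nonlin (p s) (q s) ξ with hN'
  have hint : ∫ s in (0 : ℝ)..t, heat c ξ (t - s) • N' s =
      W • ∫ s in (0 : ℝ)..t, heat c ξ (t - s) • nonlin (p s) (q s) ξ := by
    rw [← intervalIntegral.integral_smul]
    refine intervalIntegral.integral_congr fun s _ => ?_
    simp only [hN']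
    rw [smul_comm]
  have hnormint : ‖∫ s in (0 : ℝ)..t, heat c ξ (t - s) • N' s‖ₑ =
      ENNReal.ofReal W * ‖∫ s in (0 : ℝ)..t, heat c ξ (t - s) • nonlin (p s) (q s) ξ‖ₑ := by
    rw [hint, enorm_smul, Real.enorm_eq_ofReal hW0]
  -- the hypotheses of the weighted time lemma
  set φ : ℝ → ℝ≥0∞ := fun s => ENNReal.ofReal W * (C * (P s ⋆ₗ Q s) ξ) with hφ
  have hN : ∀ s ∈ Icc 0 T, ‖N' s‖ₑ ≤ ENNReal.ofReal ‖ξ‖ * φ s := by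
    intro s _
    rw [hN', enorm_smul, Real.enorm_eq_ofReal hW0, hφ]
    calc ENNReal.ofReal W * ‖nonlin (p s) (q s) ξ‖ₑ
        ≤ ENNReal.ofReal W * (ENNReal.ofReal ‖ξ‖ * (C * (P s ⋆ₗ Q s) ξ)) := by
          gcongr
          refine hpi fun l => ?_
          calc ‖nonlin (p s) (q s) ξ l‖ₑ ≤ _ := enorm_nonlin_apply_le (p s) (q s) ξ l
            _ = ENNReal.ofReal ‖ξ‖ * (C * (P s ⋆ₗ Q s) ξ) := by rw [hC, hP, hQ]; ring
      _ = _ := by ring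
  have hΦ : ∀ s ∈ Icc 0 T, ENNReal.ofReal (Real.exp (-lam * s)) * φ s ≤
      C * 2 ^ k * (X₁ ξ + X₂ ξ) := by
    intro s hs
    have hpeetre : ENNReal.ofReal W * (P s ⋆ₗ Q s) ξ ≤
        2 ^ k * ((P s ⋆ₗ fun η => ENNReal.ofReal ((1 + ‖η‖) ^ k) * Q s η) ξ +
          ((fun η => ENNReal.ofReal ((1 + ‖η‖) ^ k) * P s η) ⋆ₗ Q s) ξ) :=
      weight_mul_lconv_le (hPm s) (hQm s) k ξ
    calc ENNReal.ofReal (Real.exp (-lam * s)) * φ s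
        = C * (ENNReal.ofReal (Real.exp (-lam * s)) * (ENNReal.ofReal W * (P s ⋆ₗ Q s) ξ)) := by
          rw [hφ]; ring
      _ ≤ C * (ENNReal.ofReal (Real.exp (-lam * s)) * (2 ^ k *
          ((P s ⋆ₗ fun η => ENNReal.ofReal ((1 + ‖η‖) ^ k) * Q s η) ξ +
            ((fun η => ENNReal.ofReal ((1 + ‖η‖) ^ k) * P s η) ⋆ₗ Q s) ξ))) := by
          gcongr
      _ = C * 2 ^ k * (ENNReal.ofReal (Real.exp (-lam * s)) *
            (P s ⋆ₗ fun η => ENNReal.ofReal ((1 + ‖η‖) ^ k) * Q s η) ξ +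
          ENNReal.ofReal (Real.exp (-lam * s)) *
            ((fun η => ENNReal.ofReal ((1 + ‖η‖) ^ k) * P s η) ⋆ₗ Q s) ξ) := by ring
      _ ≤ C * 2 ^ k * (X₁ ξ + X₂ ξ) := by gcongr; exacts [h1 s hs, h2 s hs]
  have h := exp_mul_enorm_duhamel_le (N := N') (ξ := ξ) hc hlam hN hΦ ht
  rw [hnormint] at h
  calc ENNReal.ofReal (Real.exp (-lam * t)) * (ENNReal.ofReal ((1 + ‖ξ‖) ^ k) *
        ‖∫ s in (0 : ℝ)..t, heat c ξ (t - s) • nonlin (p s) (q s) ξ‖ₑ)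
      ≤ ENNReal.ofReal (1 / (2 * Real.sqrt (c * lam))) * (C * 2 ^ k * (X₁ ξ + X₂ ξ)) := h
    _ = _ := by rw [hC]

end Master


/-! ### The `λ`-free envelope of the Duhamel part of the next iterate (dimension three) -/

section Envelope

variable {c T : ℝ} {a : EuclideanSpace ℝ (Fin 3) → Fin 3 → ℂ}
  {E : ℝ → EuclideanSpace ℝ (Fin 3) → Fin 3 → ℂ}

/-- **Time-uniform envelope of the Duhamel part.** For `v = h - E` (`E` of the class, `c > 0`,
`T ≥ 0`) and every `t ∈ ℝ`, `η`:
`‖duhamelIntegral c T v t η‖ₑ ≤ Ψ(η) := (min((2c)⁻¹, ‖η‖² T) · ∫⁻_{(0,T]} φ_η²)^{1/2}`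
(`enorm_bilinDuhamel_sq_le`, `enorm_bilinDuhamel_sq_le_low` at the clamped time). [cite: Tao2011, Thm. 5.4 (ii) WITH force (arXiv:1108.1165 Thm. 31 (ii), p. 18);
proof of Thm. 5.1 (arXiv Thm. 28, p. 16); Lemma 2.1 = arXiv Lemma 23] -/
theorem enorm_duhamelIntegral_hsub_le_psi' (hc : 0 < c) (hT : 0 ≤ T) (ha : AEStronglyMeasurable a volume)
    (haw : ∀ (k : ℕ) j, ∫⁻ η, (ENNReal.ofReal ((1 + ‖η‖) ^ k) * ‖a η j‖ₑ) ^ 2 < ⊤)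
    (hEm : Measurable (uncurry E)) (hEt : ∀ η, Continuous fun s => E s η)
    (hEd : ∀ K : ℕ, ∃ B : ℝ, ∀ t, HasDecay K B (E t))
    (t : ℝ) (η : EuclideanSpace ℝ (Fin 3)) :
    ‖duhamelIntegral c T (fun s ζ => heat c ζ (clamp T s) • a ζ - E s ζ) t η‖ₑ ≤
      (min (ENNReal.ofReal (1 / (2 * c))) (ENNReal.ofReal (‖η‖ ^ 2 * T)) *
        ∫⁻ s in Ioc 0 T, (ENNReal.ofReal (4 * π) * (Fintype.card (Fin 3) : ℝ≥0∞) ^ 2 *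
          ‖fconv (fun ζ => ((∑ j, ‖(heat c ζ (clamp T s) • a ζ - E s ζ) j‖ : ℝ) : ℂ))
            (fun ζ => ((∑ j, ‖(heat c ζ (clamp T s) • a ζ - E s ζ) j‖ : ℝ) : ℂ)) η‖ₑ) ^ 2) ^
        (1 / 2 : ℝ) := by
  set v : ℝ → EuclideanSpace ℝ (Fin 3) → Fin 3 → ℂ := fun s ζ => heat c ζ (clamp T s) • a ζ - E s ζ with hv
  set m₀ := Module.finrank ℝ (EuclideanSpace ℝ (Fin 3)) + 1 with hm₀
  have hm₀lt : Module.finrank ℝ (EuclideanSpace ℝ (Fin 3)) < 2 * m₀ := finrank_lt_two_mul_succ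
  have ha2 : ∀ j, ∫⁻ η, ‖a η j‖ₑ ^ 2 < ⊤ := fun j => by simpa using haw 0 j
  obtain ⟨B₀, hB₀⟩ := hEd m₀
  have hvm : ∀ s, AEStronglyMeasurable (v s) volume := aestronglyMeasurable_hsub_slice' c T a E ha hEm
  have hv2 : ∀ s j, MemLp (v s · j) 2 volume := memLp_hsub_apply' c T a E hc.le ha ha2 hEm hm₀lt hB₀
  have hvc : ∀ j s₀, Tendsto (fun s => eLpNorm ((v s · j) - (v s₀ · j)) 2 volume) (𝓝 s₀) (𝓝 0) :=
    tendsto_eLpNorm_hsub_apply' c T a E hc.le ha ha2 hEm hEt hm₀lt hB₀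
  have ht' : clamp T t ∈ Icc 0 T := clamp_mem_Icc hT t
  have h1 := enorm_bilinDuhamel_sq_le (T := T) hc hvm hvm hv2 hv2 hvc hvc ht' η
  have h2 := enorm_bilinDuhamel_sq_le_low (T := T) hc.le hvm hvm hv2 hv2 hvc hvc ht' η
  have hroot : ∀ {x A : ℝ≥0∞}, x ^ 2 ≤ A → x ≤ A ^ (1 / 2 : ℝ) := fun {x A} h =>
    calc x = (x ^ 2) ^ (1 / 2 : ℝ) := by rw [← ENNReal.rpow_natCast, ← ENNReal.rpow_mul]; norm_num
      _ ≤ A ^ (1 / 2 : ℝ) := ENNReal.rpow_le_rpow h (by norm_num)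
  refine hroot ?_
  rw [← min_mul_mul_right]
  exact le_min h1 h2

/-- **Time-uniform envelope of the Duhamel part.** For `v = h - E` (`E` of the class, `c > 0`,
`T ≥ 0`) and every `t ∈ ℝ`, `η`:
`‖duhamelIntegral c T v t η‖ₑ ≤ Ψ(η) := (min((2c)⁻¹, ‖η‖² T) · ∫⁻_{(0,T]} φ_η²)^{1/2}`
(`enorm_bilinDuhamel_sq_le`, `enorm_bilinDuhamel_sq_le_low` at the clamped time). [folklore] -/
theorem enorm_duhamelIntegral_hsub_le_psi (hc : 0 < c) (hT : 0 ≤ T) (ha : AEStronglyMeasurable a volume)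
    (haw : ∀ (k : ℕ) j, ∫⁻ η, (ENNReal.ofReal ((1 + ‖η‖) ^ k) * ‖a η j‖ₑ) ^ 2 < ⊤)
    (hEc : Continuous (uncurry E)) (hEd : ∀ K : ℕ, ∃ B : ℝ, ∀ t, HasDecay K B (E t))
    (t : ℝ) (η : EuclideanSpace ℝ (Fin 3)) :
    ‖duhamelIntegral c T (fun s ζ => heat c ζ (clamp T s) • a ζ - E s ζ) t η‖ₑ ≤
      (min (ENNReal.ofReal (1 / (2 * c))) (ENNReal.ofReal (‖η‖ ^ 2 * T)) *
        ∫⁻ s in Ioc 0 T, (ENNReal.ofReal (4 * π) * (Fintype.card (Fin 3) : ℝ≥0∞) ^ 2 *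
          ‖fconv (fun ζ => ((∑ j, ‖(heat c ζ (clamp T s) • a ζ - E s ζ) j‖ : ℝ) : ℂ))
            (fun ζ => ((∑ j, ‖(heat c ζ (clamp T s) • a ζ - E s ζ) j‖ : ℝ) : ℂ)) η‖ₑ) ^ 2) ^
        (1 / 2 : ℝ) :=
  enorm_duhamelIntegral_hsub_le_psi' hc hT ha haw hEc.measurable (fun η => hEc.uncurry_right η) hEd t η

/-- The elementary weight bound behind the `L¹` control of the envelope:
`(1+ρ)⁴ min((2c)⁻¹, ρ²T) ≤ 8 (T ρ² + (2c)⁻¹ ρ⁴)` (`(1+ρ)⁴ ≤ 8(1+ρ⁴)`), `ℝ≥0∞` form. [folklore] -/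
theorem weight_four_mul_min_le (c T : ℝ) (η : EuclideanSpace ℝ (Fin 3)) :
    ENNReal.ofReal ((1 + ‖η‖) ^ 2) ^ 2 *
        min (ENNReal.ofReal (1 / (2 * c))) (ENNReal.ofReal (‖η‖ ^ 2 * T)) ≤
      8 * (ENNReal.ofReal T * ENNReal.ofReal (‖η‖ ^ 2) +
        ENNReal.ofReal (1 / (2 * c)) * ENNReal.ofReal (‖η‖ ^ 4)) := by
  set ρ : ℝ := ‖η‖ with hρ
  have hρ0 : 0 ≤ ρ := norm_nonneg _
  have hw : ENNReal.ofReal ((1 + ρ) ^ 2) ^ 2 ≤ 8 * (1 + ENNReal.ofReal (ρ ^ 4)) := by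
    rw [← ENNReal.ofReal_pow (by positivity), ← ENNReal.ofReal_one, ← ENNReal.ofReal_add zero_le_one
      (by positivity), ← ENNReal.ofReal_ofNat, ← ENNReal.ofReal_mul (by norm_num)]
    refine ENNReal.ofReal_le_ofReal ?_
    nlinarith [mul_nonneg (sq_nonneg (ρ - 1)) (by positivity : (0 : ℝ) ≤ 7 * ρ ^ 2 + 10 * ρ + 7)]
  set A := ENNReal.ofReal (1 / (2 * c)) with hA
  set B := ENNReal.ofReal (ρ ^ 2 * T) with hB
  calc ENNReal.ofReal ((1 + ρ) ^ 2) ^ 2 * min A B ≤ 8 * (1 + ENNReal.ofReal (ρ ^ 4)) * min A B :=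
        mul_le_mul' hw le_rfl
    _ = 8 * (min A B + ENNReal.ofReal (ρ ^ 4) * min A B) := by ring
    _ ≤ 8 * (B + ENNReal.ofReal (ρ ^ 4) * A) :=
        mul_le_mul' le_rfl (add_le_add (min_le_right _ _) (mul_le_mul' le_rfl (min_le_left _ _)))
    _ = _ := by
        rw [hB, mul_comm (ρ ^ 2) T, ENNReal.ofReal_mul' (sq_nonneg ρ)]
        ring

/-- **Weighted square moment of the envelope**: with `Ψ` as in
`enorm_duhamelIntegral_hsub_le_psi` and `I₁ = ∫ ‖ξ‖² ∫⁻φ²`, `I₂ = ∫ ‖ξ‖⁴ ∫⁻φ²`,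
`∫⁻ ((1+‖η‖)² Ψ(η))² ≤ 8 (T I₁ + (2c)⁻¹ I₂)`. Along the Picard iteration `I₁`, `I₂` are bounded
uniformly (`FourierL2PicardBounds`), so `Ψ` is an `n`-uniform `L²`-with-weight-`w²` (hence
`L¹ ∩ L²`) majorant of the Duhamel parts. [cite: Tao2011, Thm. 5.4 (ii) WITH force (arXiv:1108.1165 Thm. 31 (ii), p. 18);
proof of Thm. 5.1 (arXiv Thm. 28, p. 16); Lemma 2.1 = arXiv Lemma 23] -/
theorem lintegral_weight_psi_sq_le' (hc : 0 < c) (ha : AEStronglyMeasurable a volume)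
    (haw : ∀ (k : ℕ) j, ∫⁻ η, (ENNReal.ofReal ((1 + ‖η‖) ^ k) * ‖a η j‖ₑ) ^ 2 < ⊤)
    (hEm : Measurable (uncurry E)) (hEt : ∀ η, Continuous fun s => E s η)
    (hEd : ∀ K : ℕ, ∃ B : ℝ, ∀ t, HasDecay K B (E t)) :
    ∫⁻ η, (ENNReal.ofReal ((1 + ‖η‖) ^ 2) *
        ((min (ENNReal.ofReal (1 / (2 * c))) (ENNReal.ofReal (‖η‖ ^ 2 * T)) *
          ∫⁻ s in Ioc 0 T, (ENNReal.ofReal (4 * π) * (Fintype.card (Fin 3) : ℝ≥0∞) ^ 2 *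
            ‖fconv (fun ζ => ((∑ j, ‖(heat c ζ (clamp T s) • a ζ - E s ζ) j‖ : ℝ) : ℂ))
              (fun ζ => ((∑ j, ‖(heat c ζ (clamp T s) • a ζ - E s ζ) j‖ : ℝ) : ℂ)) η‖ₑ) ^ 2) ^
          (1 / 2 : ℝ))) ^ 2 ≤
      8 * (ENNReal.ofReal T * (∫⁻ ξ, ENNReal.ofReal (‖ξ‖ ^ 2) * ∫⁻ s in Ioc 0 T,
          (ENNReal.ofReal (4 * π) * (Fintype.card (Fin 3) : ℝ≥0∞) ^ 2 *
            ‖fconv (fun ζ => ((∑ j, ‖(heat c ζ (clamp T s) • a ζ - E s ζ) j‖ : ℝ) : ℂ))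
              (fun ζ => ((∑ j, ‖(heat c ζ (clamp T s) • a ζ - E s ζ) j‖ : ℝ) : ℂ)) ξ‖ₑ) ^ 2) +
        ENNReal.ofReal (1 / (2 * c)) * (∫⁻ ξ, ENNReal.ofReal (‖ξ‖ ^ 4) * ∫⁻ s in Ioc 0 T,
          (ENNReal.ofReal (4 * π) * (Fintype.card (Fin 3) : ℝ≥0∞) ^ 2 *
            ‖fconv (fun ζ => ((∑ j, ‖(heat c ζ (clamp T s) • a ζ - E s ζ) j‖ : ℝ) : ℂ))
              (fun ζ => ((∑ j, ‖(heat c ζ (clamp T s) • a ζ - E s ζ) j‖ : ℝ) : ℂ)) ξ‖ₑ) ^ 2)) := by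
  set v : ℝ → EuclideanSpace ℝ (Fin 3) → Fin 3 → ℂ := fun s ζ => heat c ζ (clamp T s) • a ζ - E s ζ with hv
  set m₀ := Module.finrank ℝ (EuclideanSpace ℝ (Fin 3)) + 1 with hm₀
  have hm₀lt : Module.finrank ℝ (EuclideanSpace ℝ (Fin 3)) < 2 * m₀ := finrank_lt_two_mul_succ
  have ha2 : ∀ j, ∫⁻ η, ‖a η j‖ₑ ^ 2 < ⊤ := fun j => by simpa using haw 0 j
  obtain ⟨B₀, hB₀⟩ := hEd m₀
  have hvm : ∀ s, AEStronglyMeasurable (v s) volume := aestronglyMeasurable_hsub_slice' c T a E ha hEm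
  have hv2 : ∀ s j, MemLp (v s · j) 2 volume := memLp_hsub_apply' c T a E hc.le ha ha2 hEm hm₀lt hB₀
  have hvc : ∀ j s₀, Tendsto (fun s => eLpNorm ((v s · j) - (v s₀ · j)) 2 volume) (𝓝 s₀) (𝓝 0) :=
    tendsto_eLpNorm_hsub_apply' c T a E hc.le ha ha2 hEm hEt hm₀lt hB₀
  set C : ℝ≥0∞ := ENNReal.ofReal (4 * π) * (Fintype.card (Fin 3) : ℝ≥0∞) ^ 2 with hC
  set Φsq : EuclideanSpace ℝ (Fin 3) → ℝ≥0∞ := fun ξ => ∫⁻ s in Ioc 0 T,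
    (C * ‖fconv (fun ζ => ((∑ j, ‖v s ζ j‖ : ℝ) : ℂ)) (fun ζ => ((∑ j, ‖v s ζ j‖ : ℝ) : ℂ)) ξ‖ₑ) ^ 2
    with hΦsq
  have hΦm : Measurable Φsq :=
    ((measurable_phi hvm hvm hv2 hv2 hvc hvc C).pow_const 2).lintegral_prod_left'
      (μ := volume.restrict (Ioc 0 T))
  set A := ENNReal.ofReal (1 / (2 * c)) with hA
  -- pointwise
  have hhalf : ∀ X : ℝ≥0∞, (X ^ (1 / 2 : ℝ)) ^ 2 = X := fun X => by
    rw [← ENNReal.rpow_natCast, ← ENNReal.rpow_mul]; norm_num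
  have hpt : ∀ η, (ENNReal.ofReal ((1 + ‖η‖) ^ 2) *
      ((min A (ENNReal.ofReal (‖η‖ ^ 2 * T))) * Φsq η) ^ (1 / 2 : ℝ)) ^ 2 ≤
      8 * (ENNReal.ofReal T * (ENNReal.ofReal (‖η‖ ^ 2) * Φsq η)) +
        8 * (A * (ENNReal.ofReal (‖η‖ ^ 4) * Φsq η)) := by
    intro η
    rw [mul_pow, hhalf, ← mul_assoc]
    calc ENNReal.ofReal ((1 + ‖η‖) ^ 2) ^ 2 * min A (ENNReal.ofReal (‖η‖ ^ 2 * T)) * Φsq η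
        ≤ 8 * (ENNReal.ofReal T * ENNReal.ofReal (‖η‖ ^ 2) + A * ENNReal.ofReal (‖η‖ ^ 4)) * Φsq η :=
          mul_le_mul' (weight_four_mul_min_le c T η) le_rfl
      _ = _ := by ring
  have hm1 : AEMeasurable (fun η => 8 * (ENNReal.ofReal T * (ENNReal.ofReal (‖η‖ ^ 2) * Φsq η))) volume :=
    ((((ENNReal.continuous_ofReal.comp (continuous_norm.pow 2)).measurable.mul hΦm).const_mul _
      ).const_mul _).aemeasurable
  calc _ ≤ ∫⁻ η, (8 * (ENNReal.ofReal T * (ENNReal.ofReal (‖η‖ ^ 2) * Φsq η)) +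
        8 * (A * (ENNReal.ofReal (‖η‖ ^ 4) * Φsq η))) := lintegral_mono hpt
    _ = 8 * (ENNReal.ofReal T * ∫⁻ η, ENNReal.ofReal (‖η‖ ^ 2) * Φsq η) +
        8 * (A * ∫⁻ η, ENNReal.ofReal (‖η‖ ^ 4) * Φsq η) := by
        rw [lintegral_add_left' hm1, lintegral_const_mul' _ _ (by norm_num),
          lintegral_const_mul' _ _ ENNReal.ofReal_ne_top, lintegral_const_mul' _ _ (by norm_num),
          lintegral_const_mul' _ _ ENNReal.ofReal_ne_top]
    _ = _ := by ring

/-- **Weighted square moment of the envelope**: with `Ψ` as in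
`enorm_duhamelIntegral_hsub_le_psi` and `I₁ = ∫ ‖ξ‖² ∫⁻φ²`, `I₂ = ∫ ‖ξ‖⁴ ∫⁻φ²`,
`∫⁻ ((1+‖η‖)² Ψ(η))² ≤ 8 (T I₁ + (2c)⁻¹ I₂)`. Along the Picard iteration `I₁`, `I₂` are bounded
uniformly (`FourierL2PicardBounds`), so `Ψ` is an `n`-uniform `L²`-with-weight-`w²` (hence
`L¹ ∩ L²`) majorant of the Duhamel parts. [folklore] -/
theorem lintegral_weight_psi_sq_le (hc : 0 < c) (ha : AEStronglyMeasurable a volume)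
    (haw : ∀ (k : ℕ) j, ∫⁻ η, (ENNReal.ofReal ((1 + ‖η‖) ^ k) * ‖a η j‖ₑ) ^ 2 < ⊤)
    (hEc : Continuous (uncurry E)) (hEd : ∀ K : ℕ, ∃ B : ℝ, ∀ t, HasDecay K B (E t)) :
    ∫⁻ η, (ENNReal.ofReal ((1 + ‖η‖) ^ 2) *
        ((min (ENNReal.ofReal (1 / (2 * c))) (ENNReal.ofReal (‖η‖ ^ 2 * T)) *
          ∫⁻ s in Ioc 0 T, (ENNReal.ofReal (4 * π) * (Fintype.card (Fin 3) : ℝ≥0∞) ^ 2 *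
            ‖fconv (fun ζ => ((∑ j, ‖(heat c ζ (clamp T s) • a ζ - E s ζ) j‖ : ℝ) : ℂ))
              (fun ζ => ((∑ j, ‖(heat c ζ (clamp T s) • a ζ - E s ζ) j‖ : ℝ) : ℂ)) η‖ₑ) ^ 2) ^
          (1 / 2 : ℝ))) ^ 2 ≤
      8 * (ENNReal.ofReal T * (∫⁻ ξ, ENNReal.ofReal (‖ξ‖ ^ 2) * ∫⁻ s in Ioc 0 T,
          (ENNReal.ofReal (4 * π) * (Fintype.card (Fin 3) : ℝ≥0∞) ^ 2 *
            ‖fconv (fun ζ => ((∑ j, ‖(heat c ζ (clamp T s) • a ζ - E s ζ) j‖ : ℝ) : ℂ))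
              (fun ζ => ((∑ j, ‖(heat c ζ (clamp T s) • a ζ - E s ζ) j‖ : ℝ) : ℂ)) ξ‖ₑ) ^ 2) +
        ENNReal.ofReal (1 / (2 * c)) * (∫⁻ ξ, ENNReal.ofReal (‖ξ‖ ^ 4) * ∫⁻ s in Ioc 0 T,
          (ENNReal.ofReal (4 * π) * (Fintype.card (Fin 3) : ℝ≥0∞) ^ 2 *
            ‖fconv (fun ζ => ((∑ j, ‖(heat c ζ (clamp T s) • a ζ - E s ζ) j‖ : ℝ) : ℂ))
              (fun ζ => ((∑ j, ‖(heat c ζ (clamp T s) • a ζ - E s ζ) j‖ : ℝ) : ℂ)) ξ‖ₑ) ^ 2)) :=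
  lintegral_weight_psi_sq_le' hc ha haw hEc.measurable (fun η => hEc.uncurry_right η) hEd


/-- Measurability of the envelope `Ψ`. [cite: Tao2011, Thm. 5.4 (ii) WITH force (arXiv:1108.1165 Thm. 31 (ii), p. 18);
proof of Thm. 5.1 (arXiv Thm. 28, p. 16); Lemma 2.1 = arXiv Lemma 23] -/
theorem measurable_psi' (hc : 0 < c) (ha : AEStronglyMeasurable a volume)
    (haw : ∀ (k : ℕ) j, ∫⁻ η, (ENNReal.ofReal ((1 + ‖η‖) ^ k) * ‖a η j‖ₑ) ^ 2 < ⊤)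
    (hEm : Measurable (uncurry E)) (hEt : ∀ η, Continuous fun s => E s η)
    (hEd : ∀ K : ℕ, ∃ B : ℝ, ∀ t, HasDecay K B (E t)) :
    Measurable fun η : EuclideanSpace ℝ (Fin 3) =>
      (min (ENNReal.ofReal (1 / (2 * c))) (ENNReal.ofReal (‖η‖ ^ 2 * T)) *
        ∫⁻ s in Ioc 0 T, (ENNReal.ofReal (4 * π) * (Fintype.card (Fin 3) : ℝ≥0∞) ^ 2 *
          ‖fconv (fun ζ => ((∑ j, ‖(heat c ζ (clamp T s) • a ζ - E s ζ) j‖ : ℝ) : ℂ))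
            (fun ζ => ((∑ j, ‖(heat c ζ (clamp T s) • a ζ - E s ζ) j‖ : ℝ) : ℂ)) η‖ₑ) ^ 2) ^
        (1 / 2 : ℝ) := by
  set v : ℝ → EuclideanSpace ℝ (Fin 3) → Fin 3 → ℂ := fun s ζ => heat c ζ (clamp T s) • a ζ - E s ζ with hv
  set m₀ := Module.finrank ℝ (EuclideanSpace ℝ (Fin 3)) + 1 with hm₀
  have hm₀lt : Module.finrank ℝ (EuclideanSpace ℝ (Fin 3)) < 2 * m₀ := finrank_lt_two_mul_succ
  have ha2 : ∀ j, ∫⁻ η, ‖a η j‖ₑ ^ 2 < ⊤ := fun j => by simpa using haw 0 j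
  obtain ⟨B₀, hB₀⟩ := hEd m₀
  have hvm : ∀ s, AEStronglyMeasurable (v s) volume := aestronglyMeasurable_hsub_slice' c T a E ha hEm
  have hv2 : ∀ s j, MemLp (v s · j) 2 volume := memLp_hsub_apply' c T a E hc.le ha ha2 hEm hm₀lt hB₀
  have hvc : ∀ j s₀, Tendsto (fun s => eLpNorm ((v s · j) - (v s₀ · j)) 2 volume) (𝓝 s₀) (𝓝 0) :=
    tendsto_eLpNorm_hsub_apply' c T a E hc.le ha ha2 hEm hEt hm₀lt hB₀
  have hΦm : Measurable fun ξ : EuclideanSpace ℝ (Fin 3) => ∫⁻ s in Ioc 0 T,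
      (ENNReal.ofReal (4 * π) * (Fintype.card (Fin 3) : ℝ≥0∞) ^ 2 *
        ‖fconv (fun ζ => ((∑ j, ‖v s ζ j‖ : ℝ) : ℂ)) (fun ζ => ((∑ j, ‖v s ζ j‖ : ℝ) : ℂ)) ξ‖ₑ) ^ 2 :=
    ((measurable_phi hvm hvm hv2 hv2 hvc hvc _).pow_const 2).lintegral_prod_left'
      (μ := volume.restrict (Ioc 0 T))
  have hmin : Measurable fun η : EuclideanSpace ℝ (Fin 3) =>
      min (ENNReal.ofReal (1 / (2 * c))) (ENNReal.ofReal (‖η‖ ^ 2 * T)) :=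
    measurable_const.min ((ENNReal.continuous_ofReal.comp ((continuous_norm.pow 2).mul
      continuous_const)).measurable)
  exact (hmin.mul hΦm).pow_const _

/-- Measurability of the envelope `Ψ`. [folklore] -/
theorem measurable_psi (hc : 0 < c) (ha : AEStronglyMeasurable a volume)
    (haw : ∀ (k : ℕ) j, ∫⁻ η, (ENNReal.ofReal ((1 + ‖η‖) ^ k) * ‖a η j‖ₑ) ^ 2 < ⊤)
    (hEc : Continuous (uncurry E)) (hEd : ∀ K : ℕ, ∃ B : ℝ, ∀ t, HasDecay K B (E t)) :
    Measurable fun η : EuclideanSpace ℝ (Fin 3) =>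
      (min (ENNReal.ofReal (1 / (2 * c))) (ENNReal.ofReal (‖η‖ ^ 2 * T)) *
        ∫⁻ s in Ioc 0 T, (ENNReal.ofReal (4 * π) * (Fintype.card (Fin 3) : ℝ≥0∞) ^ 2 *
          ‖fconv (fun ζ => ((∑ j, ‖(heat c ζ (clamp T s) • a ζ - E s ζ) j‖ : ℝ) : ℂ))
            (fun ζ => ((∑ j, ‖(heat c ζ (clamp T s) • a ζ - E s ζ) j‖ : ℝ) : ℂ)) η‖ₑ) ^ 2) ^
        (1 / 2 : ℝ) :=
  measurable_psi' hc ha haw hEc.measurable (fun η => hEc.uncurry_right η) hEd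

end Envelope

/-! ### Uniform envelopes along the Picard iteration -/

section Iteration

variable {c T : ℝ} {a : EuclideanSpace ℝ (Fin 3) → Fin 3 → ℂ}

/-- **`n`-uniform `λ`-free envelopes of the Duhamel parts of the Picard iterates.** Under the
hypotheses of `picard_uniform_bounds` (Tao's smallness condition), there is a finite `Λ` such that
every `E_n = h - picardIter c T a n` admits a measurable, time-independent envelope
`‖E_n(t, η)‖ₑ ≤ Ψ_n(η)` (all `t ∈ ℝ`) with `∫⁻ ((1+‖η‖)² Ψ_n)² ≤ Λ`; in particular
`‖Ψ_n‖_{L¹} ≤ ‖(1+‖·‖)^{-2}‖_{L²} Λ^{1/2}` and `‖Ψ_n‖_{L²} ≤ Λ^{1/2}` uniformly in `n`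
(`Ψ_0 = 0`; `Ψ_{n+1}` from `enorm_duhamelIntegral_hsub_le_psi`, `lintegral_weight_psi_sq_le`
and the uniform bounds `I₁(v_n) ≤ 32C²K₃²θα₁²`, `I₂(v_n) ≤ 128C²K₃²θα₁α₂`).
[cite: Tao2011, Thm. 5.4 (ii) (arXiv Thm. 31), proof of Thm. 5.1 (arXiv p. 16)] -/
theorem exists_uniform_envelope_picardIter (hc : 0 < c) (hT : 0 ≤ T)
    (ha : AEStronglyMeasurable a volume)
    (haw : ∀ (k : ℕ) j, ∫⁻ η, (ENNReal.ofReal ((1 + ‖η‖) ^ k) * ‖a η j‖ₑ) ^ 2 < ⊤)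
    (hs : 2304 * (ENNReal.ofReal (4 * π) * (Fintype.card (Fin 3) : ℝ≥0∞) ^ 2) ^ 2 *
        ((SNormLESNormFDerivOfEqConst ℂ (volume : Measure (EuclideanSpace ℝ (Fin 3))) 2 *
          ENNReal.ofReal (2 * π)) ^ (3 / 2 : ℝ)) ^ 2 * ENNReal.ofReal c⁻¹ *
        (ENNReal.ofReal T * ENNReal.ofReal (2 / c)) ^ (1 / 2 : ℝ) *
        (∫⁻ η, (ENNReal.ofReal ‖η‖ * ∑ j, ‖a η j‖ₑ) ^ 2) ≤ 1) :
    ∃ Λ : ℝ≥0∞, Λ < ⊤ ∧ ∀ n : ℕ, ∃ Ψ : EuclideanSpace ℝ (Fin 3) → ℝ≥0∞, Measurable Ψ ∧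
      (∀ t η, ‖heat c η (clamp T t) • a η - picardIter c T a n t η‖ₑ ≤ Ψ η) ∧
      ∫⁻ η, (ENNReal.ofReal ((1 + ‖η‖) ^ 2) * Ψ η) ^ 2 ≤ Λ := by
  set C : ℝ≥0∞ := ENNReal.ofReal (4 * π) * (Fintype.card (Fin 3) : ℝ≥0∞) ^ 2 with hC
  set K3 : ℝ≥0∞ := (SNormLESNormFDerivOfEqConst ℂ (volume : Measure (EuclideanSpace ℝ (Fin 3))) 2 *
    ENNReal.ofReal (2 * π)) ^ (3 / 2 : ℝ) with hK3
  set α₁ : ℝ≥0∞ := ∫⁻ η, (ENNReal.ofReal ‖η‖ * ∑ j, ‖a η j‖ₑ) ^ 2 with hα₁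
  set α₂ : ℝ≥0∞ := ∫⁻ η, (ENNReal.ofReal (‖η‖ ^ 2) * ∑ j, ‖a η j‖ₑ) ^ 2 with hα₂
  -- finiteness of the data quantities
  have hαw : ∀ k : ℕ, ∫⁻ η, (ENNReal.ofReal (‖η‖ ^ k) * ∑ j, ‖a η j‖ₑ) ^ 2 < ⊤ := fun k => by
    refine lt_of_le_of_lt (lintegral_mono fun η => ?_) (lintegral_weight_majorant_sq_lt_top ha k (haw k))
    gcongr
    exact le_add_of_nonneg_left zero_le_one
  have hα₁ : α₁ < ⊤ := by simpa only [pow_one] using hαw 1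
  have hα₂ : α₂ < ⊤ := hαw 2
  have hCtop : C < ⊤ := ENNReal.mul_lt_top ENNReal.ofReal_lt_top (by simp)
  have hK3top : K3 < ⊤ :=
    ENNReal.rpow_lt_top_of_nonneg (by norm_num) (ENNReal.mul_ne_top ENNReal.coe_ne_top ENNReal.ofReal_ne_top)
  have hrt : ∀ {x : ℝ≥0∞}, x < ⊤ → x ^ (1 / 2 : ℝ) < ⊤ := fun h =>
    ENNReal.rpow_lt_top_of_nonneg (by norm_num) h.ne
  -- the uniform `I₁`, `I₂` bounds
  set J₁ : ℝ≥0∞ := 4 * C ^ 2 * K3 ^ 2 * ((4 * α₁) ^ (1 / 2 : ℝ) * (4 * α₁) *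
    (ENNReal.ofReal T * (ENNReal.ofReal (2 / c) * α₁)) ^ (1 / 2 : ℝ)) with hJ₁
  set J₂ : ℝ≥0∞ := 16 * C ^ 2 * K3 ^ 2 * ((4 * α₂) ^ (1 / 2 : ℝ) * (4 * α₁) *
    (ENNReal.ofReal T * (ENNReal.ofReal (2 / c) * α₂)) ^ (1 / 2 : ℝ)) with hJ₂
  have hJ₁top : J₁ < ⊤ := by
    refine ENNReal.mul_lt_top (ENNReal.mul_lt_top (ENNReal.mul_lt_top (by norm_num)
      (ENNReal.pow_lt_top hCtop)) (ENNReal.pow_lt_top hK3top)) ?_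
    exact ENNReal.mul_lt_top (ENNReal.mul_lt_top (hrt (ENNReal.mul_lt_top (by norm_num) hα₁))
      (ENNReal.mul_lt_top (by norm_num) hα₁)) (hrt (ENNReal.mul_lt_top ENNReal.ofReal_lt_top
        (ENNReal.mul_lt_top ENNReal.ofReal_lt_top hα₁)))
  have hJ₂top : J₂ < ⊤ := by
    refine ENNReal.mul_lt_top (ENNReal.mul_lt_top (ENNReal.mul_lt_top (by norm_num)
      (ENNReal.pow_lt_top hCtop)) (ENNReal.pow_lt_top hK3top)) ?_
    exact ENNReal.mul_lt_top (ENNReal.mul_lt_top (hrt (ENNReal.mul_lt_top (by norm_num) hα₂))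
      (ENNReal.mul_lt_top (by norm_num) hα₁)) (hrt (ENNReal.mul_lt_top ENNReal.ofReal_lt_top
        (ENNReal.mul_lt_top ENNReal.ofReal_lt_top hα₂)))
  refine ⟨8 * (ENNReal.ofReal T * J₁ + ENNReal.ofReal (1 / (2 * c)) * J₂), ?_, fun n => ?_⟩
  · exact ENNReal.mul_lt_top (by norm_num) (ENNReal.add_lt_top.2
      ⟨ENNReal.mul_lt_top ENNReal.ofReal_lt_top hJ₁top, ENNReal.mul_lt_top ENNReal.ofReal_lt_top hJ₂top⟩)
  cases n with
  | zero =>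
    refine ⟨fun _ => 0, measurable_const, fun t η => ?_, by simp⟩
    simp [picardIter]
  | succ n =>
    set En : ℝ → EuclideanSpace ℝ (Fin 3) → Fin 3 → ℂ :=
      fun t ξ => heat c ξ (clamp T t) • a ξ - picardIter c T a n t ξ with hEn
    have hvn : (fun s η => heat c η (clamp T s) • a η - En s η) = picardIter c T a n := by
      funext s η; simp [hEn]
    have hstep : ∀ t ξ, heat c ξ (clamp T t) • a ξ - picardIter c T a (n + 1) t ξ =
        duhamelIntegral c T (fun s η => heat c η (clamp T s) • a η - En s η) t ξ := by
      intro t ξ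
      rw [hvn, picardIter, duhamel_eq, sub_sub_cancel]
    obtain ⟨hEc, hEd⟩ := class_picardIter hc.le hT ha haw n
    obtain ⟨hA, hP, hB, hE⟩ := picard_uniform_bounds hc hT ha haw hs n
    have hA' : ∀ s ∈ Icc 0 T, ∫⁻ η, (ENNReal.ofReal ‖η‖ *
        ∑ j, ‖(heat c η (clamp T s) • a η - En s η) j‖ₑ) ^ 2 ≤ 4 * α₁ := fun s hs => by
      simpa only [hEn, sub_sub_cancel] using hA s hs
    have hP' : ∫⁻ s in Ioc 0 T, ∫⁻ η, (ENNReal.ofReal (‖η‖ ^ 2) *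
        ∑ j, ‖(heat c η (clamp T s) • a η - En s η) j‖ₑ) ^ 2 ≤ ENNReal.ofReal (2 / c) * α₁ := by
      simpa only [hEn, sub_sub_cancel] using hP
    have hB' : ∀ s ∈ Icc 0 T, ∫⁻ η, (ENNReal.ofReal (‖η‖ ^ 2) *
        ∑ j, ‖(heat c η (clamp T s) • a η - En s η) j‖ₑ) ^ 2 ≤ 4 * α₂ := fun s hs => by
      simpa only [hEn, sub_sub_cancel] using hB s hs
    have hE' : ∫⁻ s in Ioc 0 T, ∫⁻ η, (ENNReal.ofReal (‖η‖ ^ 3) *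
        ∑ j, ‖(heat c η (clamp T s) • a η - En s η) j‖ₑ) ^ 2 ≤ ENNReal.ofReal (2 / c) * α₂ := by
      simpa only [hEn, sub_sub_cancel] using hE
    have hI₁ := lintegral_sq_weight_Phi_hsub_le hc ha haw hEc hEd hA' hP'
    have hI₂ := lintegral_fourth_weight_Phi_hsub_le hc ha haw hEc hEd hA' hB' hE'
    refine ⟨_, measurable_psi (T := T) hc ha haw hEc hEd, fun t η => ?_, ?_⟩
    · rw [hstep]
      exact enorm_duhamelIntegral_hsub_le_psi hc hT ha haw hEc hEd t η
    · refine (lintegral_weight_psi_sq_le (T := T) hc ha haw hEc hEd).trans ?_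
      exact mul_le_mul' le_rfl (add_le_add (mul_le_mul' le_rfl hI₁) (mul_le_mul' le_rfl hI₂))

end Iteration

end Literature.Analysis.FluidPDE.FourierNS

end
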